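import Summits.NavierStokesRegularity.NavierStokesRegularity.Theorems.TypeICertificateLadderRungReynoldsOneOseenGaugeMild
import Literature.Analysis.FluidPDE.SolenoidalL2Duality
import HarnessLib

/-!
# Route TypeICertificateLadder — C31-M in the literal KNSS class `L^∞_loc((0,T); L^∞(ℝ³))`
  (a.e. formulation; cell pub-ns-dss; helper of crux stmt-NavierStokesRegularity-2882)

`TypeICertificateLadderRungReynoldsOneOseenGaugeMild.lean` proves C31-M for the CONTINUOUS
representative (pointwise Oseen equation between all pairs). Here the hypotheses are those of
Koch–Nadirashvili–Seregin–Šverák 2009 §4 verbatim: `u` jointly measurable on `(0,T) × ℝ³`, slices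
measurable, weakly divergence free and ESSENTIALLY bounded uniformly on every `(0,T')`, `T' < T`,
the Oseen integral equation `u(t) = e^{(t−s)Δ}u(s) − B¹_s(u,u)(t)` holding ALMOST EVERYWHERE in `x`
for every pair `0 < s < t < T`, and `‖u(t)‖_{L^∞}` unbounded on `(0,T)`. Conclusion: for every
`θ < 1`, frequently as `t ↑ T`, `θ < √(T − t)‖u(t)‖_{L^∞}` (in `ℝ≥0∞`). Proof: the KNSS canonical
representative `w(t) = e^{(t−s₀)Δ}u(s₀) − B¹_{s₀}(u,u)(t)` (`s₀ = T/2`) is jointly smooth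
(`knss2009_smoothing_holds`), equals `u(t)` a.e., and satisfies the pointwise all-pairs equation
(both sides are continuous and a.e. equal), so `lerayRate_frequently_gt_of_oseenMild_continuous`
applies to `w(· + s₀)`; finally `sup|w(t)| ≤ ‖u(t)‖_{L^∞}`.

HONEST FRAMING: a statement about a HYPOTHETICAL singular time of a hypothetical mild solution;
`1` is a perturbative threshold, nothing is said at or above it; nothing here bears on the
regularity question itself. Lands `--supports stmt-NavierStokesRegularity-2882`.
-/

noncomputable section

namespace Summit.NavierStokesRegularity.NavierStokesRegularity.Theorems

set_option linter.dupNamespace false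

open MeasureTheory Set Filter Topology Function
open scoped RealInnerProductSpace ENNReal ContDiff
open Literature.Analysis Literature.Analysis.FluidPDE

/-- **The KNSS canonical representative of an `L^∞_loc((0,T); L^∞)` mild solution** (KNSS 2009,
Prop. 4.1 and §4 p. 8). Let `u` be jointly measurable on `(0,T) × E` with measurable slices,
essentially bounded uniformly on every `(0,T')`, `T' < T`, and satisfy the Oseen equation a.e. in `x`
between all pairs of times of `(0,T)`; let `0 < s₀ < T`. Then
`w(t) = e^{(t−s₀)Δ}u(s₀) − B¹_{s₀}(u,u)(t)` is jointly `C^∞` on `(s₀,T) × E`, `w(t) = u(t)` a.e. for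
`t ∈ (s₀,T)`, `w` is bounded on every `(s₀,T') × E`, and `w` satisfies the Oseen equation POINTWISE
between all pairs of times of `(s₀,T)` (both sides are continuous and a.e. equal to `u(t)`).
[cite: KochNadirashviliSereginSverak2009, Prop. 4.1 (arXiv:0709.3599 p. 8)] -/
theorem oseenMild_ae_representative
    {E : Type*} [NormedAddCommGroup E] [InnerProductSpace ℝ E] [FiniteDimensional ℝ E]
    [MeasurableSpace E] [BorelSpace E]
    {u w : ℝ → E → E} {T s₀ : ℝ} (hs₀ : 0 < s₀) (hs₀T : s₀ < T)
    (hmeas : AEStronglyMeasurable (uncurry u) ((volume : Measure (ℝ × E)).restrict (Ioo 0 T ×ˢ univ)))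
    (hslice : ∀ t ∈ Ioo 0 T, AEStronglyMeasurable (u t) volume)
    (hbdd : ∀ T' < T, ∃ M : ℝ, ∀ t ∈ Ioo 0 T', eLpNorm (u t) ∞ volume ≤ ENNReal.ofReal M)
    (hoseen : ∀ s t : ℝ, 0 < s → s < t → t < T →
      u t =ᵐ[volume] fun x =>
        UnboundedOperators.heatExtension (u s) (t - s) x - oseenDuhamel 1 s u u t x)
    (hwdef : ∀ t x, w t x =
      UnboundedOperators.heatExtension (u s₀) (t - s₀) x - oseenDuhamel 1 s₀ u u t x) :
    IsSmoothSpaceTimeOn (Ioo s₀ T) w ∧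
      (∀ t ∈ Ioo s₀ T, w t =ᵐ[volume] u t) ∧
      (∀ T' < T, ∃ M : ℝ, ∀ t ∈ Ioo s₀ T', ∀ x, ‖w t x‖ ≤ M) ∧
      (∀ s t : ℝ, s₀ < s → s < t → t < T → ∀ X,
          w t X = UnboundedOperators.heatExtension (w s) (t - s) X - oseenDuhamel 1 s w w t X) := by
  -- `w(t) = u(t)` a.e.
  have hwu : ∀ t ∈ Ioo s₀ T, w t =ᵐ[volume] u t := fun t ht => by
    have h := (hoseen s₀ t hs₀ ht.1 ht.2).symm
    have e : w t = fun x =>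
        UnboundedOperators.heatExtension (u s₀) (t - s₀) x - oseenDuhamel 1 s₀ u u t x :=
      funext fun x => hwdef t x
    rw [e]
    exact h
  -- KNSS Prop. 4.1 on each window `(s₀, T₁)`, `T₁ < T`: smoothness and the bound
  have hwin : ∀ T₁, s₀ < T₁ → T₁ < T →
      IsSmoothSpaceTimeOn (Ioo s₀ T₁) w ∧ ∃ M : ℝ, 0 ≤ M ∧ ∀ t ∈ Ioo s₀ T₁, ∀ x, ‖w t x‖ ≤ M := by
    intro T₁ hs₀T₁ hT₁T
    obtain ⟨M₀, hM₀⟩ := hbdd T₁ hT₁T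
    set M : ℝ := max M₀ 0 with hMdef
    have hM : 0 ≤ M := le_max_right _ _
    have hMle : ENNReal.ofReal M₀ ≤ ENNReal.ofReal M := ENNReal.ofReal_le_ofReal (le_max_left _ _)
    have ha : AEStronglyMeasurable (u s₀) volume := hslice s₀ ⟨hs₀, hs₀T⟩
    have haM : eLpNorm (u s₀) ∞ volume ≤ ENNReal.ofReal M := (hM₀ s₀ ⟨hs₀, hs₀T₁⟩).trans hMle
    have hsub : Ioo s₀ T₁ ×ˢ (univ : Set E) ⊆ Ioo 0 T ×ˢ univ :=
      prod_mono (Ioo_subset_Ioo hs₀.le hT₁T.le) subset_rfl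
    have hum : AEStronglyMeasurable (uncurry u)
        ((volume : Measure (ℝ × E)).restrict (Ioo s₀ T₁ ×ˢ univ)) :=
      hmeas.mono_measure (Measure.restrict_mono hsub le_rfl)
    have huM : ∀ t ∈ Ioo s₀ T₁, eLpNorm (u t) ∞ volume ≤ ENNReal.ofReal M := fun t ht =>
      (hM₀ t ⟨hs₀.trans ht.1, ht.2⟩).trans hMle
    have husol : ∀ t ∈ Ioo s₀ T₁, u t =ᵐ[volume] fun x =>
        UnboundedOperators.heatExtension (u s₀) (1 * (t - s₀)) x - oseenDuhamel 1 s₀ u u t x :=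
      fun t ht => by
        have h := hoseen s₀ t hs₀ ht.1 (ht.2.trans hT₁T)
        simpa only [one_mul] using h
    obtain ⟨hsm, hbd, -⟩ := knss2009_smoothing_holds E one_pos hs₀T₁ hM ha haM hum huM husol
    have e : (fun t x => UnboundedOperators.heatExtension (u s₀) (1 * (t - s₀)) x
        - oseenDuhamel 1 s₀ u u t x) = w := by
      funext t x; rw [hwdef, one_mul]
    rw [e] at hsm
    refine ⟨hsm, M, hM, fun t ht x => ?_⟩
    have h := hbd t ht x
    rwa [one_mul, ← hwdef] at h
  -- (i) smoothness on `(s₀, T)` (local)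
  have hsmooth : IsSmoothSpaceTimeOn (Ioo s₀ T) w := by
    refine contDiffOn_of_locally_contDiffOn fun q hq => ?_
    obtain ⟨ht, -⟩ := mem_prod.1 hq
    set T₁ : ℝ := (q.1 + T) / 2 with hT₁
    have hqT₁ : q.1 < T₁ := by rw [hT₁]; linarith [ht.2]
    have hT₁T : T₁ < T := by rw [hT₁]; linarith [ht.2]
    refine ⟨Ioo s₀ T₁ ×ˢ univ, isOpen_Ioo.prod isOpen_univ, ⟨⟨ht.1, hqT₁⟩, mem_univ _⟩, ?_⟩
    exact ContDiffOn.mono (hwin T₁ (ht.1.trans hqT₁) hT₁T).1 inter_subset_right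
  -- (iii) bounds
  have hbddw : ∀ T' < T, ∃ M : ℝ, ∀ t ∈ Ioo s₀ T', ∀ x, ‖w t x‖ ≤ M := by
    intro T' hT'
    rcases le_or_gt T' s₀ with hle | hgt
    · exact ⟨0, fun t ht _ => absurd (ht.1.trans ht.2) (not_lt.2 hle)⟩
    · obtain ⟨-, M, -, hM⟩ := hwin T' hgt hT'
      exact ⟨M, hM⟩
  refine ⟨hsmooth, hwu, hbddw, fun s t hs₀s hst htT X => ?_⟩
  -- (iv) the pointwise equation between `s` and `t`: both sides are continuous, a.e. equal to `u t`
  have hs : s ∈ Ioo s₀ T := ⟨hs₀s, hst.trans htT⟩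
  have htI : t ∈ Ioo s₀ T := ⟨hs₀s.trans hst, htT⟩
  set T₁ : ℝ := (t + T) / 2 with hT₁
  have htT₁ : t < T₁ := by rw [hT₁]; linarith
  have hT₁T : T₁ < T := by rw [hT₁]; linarith
  obtain ⟨hsmw, M, hM, hwM⟩ := hwin T₁ (hs₀s.trans (hst.trans htT₁)) hT₁T
  have hslicew : ∀ τ ∈ Ioo s₀ T₁, Continuous (w τ) := fun τ hτ =>
    hsmw.continuousOn.comp_continuous (Continuous.prodMk_right τ) fun x => ⟨hτ, mem_univ x⟩
  -- continuity of the right-hand side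
  have hwsm : AEStronglyMeasurable (w s) volume := (hslicew s ⟨hs₀s, hst.trans htT₁⟩).aestronglyMeasurable
  have hwsLp : MemLp (w s) ∞ (volume : Measure E) :=
    memLp_top_of_bound hwsm M (Eventually.of_forall fun x => hwM s ⟨hs₀s, hst.trans htT₁⟩ x)
  have hc1 : Continuous (UnboundedOperators.heatExtension (w s) (t - s)) :=
    (UnboundedOperators.contDiff_heatExtension_holds hwsLp le_top (sub_pos.2 hst)).continuous
  have hsubw : Ioo s T₁ ×ˢ (univ : Set E) ⊆ Ioo s₀ T₁ ×ˢ univ :=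
    prod_mono (Ioo_subset_Ioo hs₀s.le le_rfl) subset_rfl
  have hwm : AEStronglyMeasurable (uncurry w)
      ((volume : Measure (ℝ × E)).restrict (Ioo s T₁ ×ˢ univ)) :=
    (hsmw.continuousOn.mono hsubw).aestronglyMeasurable (measurableSet_Ioo.prod MeasurableSet.univ)
  have hwM' : ∀ τ ∈ Ioo s T₁, ∀ y, ‖w τ y‖ ≤ M := fun τ hτ y => hwM τ ⟨hs₀s.trans hτ.1, hτ.2⟩ y
  have hc2 : Continuous (oseenDuhamel 1 s w w t) :=
    continuous_oseenDuhamel_slice one_pos hM hwm hwm hwM' hwM' hst htT₁.le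
  have hcR : Continuous fun X => UnboundedOperators.heatExtension (w s) (t - s) X
      - oseenDuhamel 1 s w w t X := hc1.sub hc2
  have hcL : Continuous (w t) := hslicew t ⟨htI.1, htT₁⟩
  -- a.e. equality of the two sides
  have hae : w t =ᵐ[volume] fun X => UnboundedOperators.heatExtension (w s) (t - s) X
      - oseenDuhamel 1 s w w t X := by
    have h1 : u t =ᵐ[volume] fun x =>
        UnboundedOperators.heatExtension (u s) (t - s) x - oseenDuhamel 1 s u u t x :=
      hoseen s t (hs₀.trans hs₀s) hst htT
    have h2 : UnboundedOperators.heatExtension (u s) (t - s) =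
        UnboundedOperators.heatExtension (w s) (t - s) :=
      UnboundedOperators.heatExtension_congr_ae' (hwu s hs).symm (t - s)
    have h3 : ∀ X, oseenDuhamel 1 s u u t X = oseenDuhamel 1 s w w t X := fun X =>
      oseenDuhamel_congr_ae_slice (fun τ hτ => (hwu τ ⟨hs₀s.trans hτ.1, hτ.2.trans htT⟩).symm)
        (fun τ hτ => (hwu τ ⟨hs₀s.trans hτ.1, hτ.2.trans htT⟩).symm) X
    filter_upwards [hwu t htI, h1] with X hX1 hX2
    rw [hX1, hX2, h2, h3 X]
  exact congrFun ((hcL.ae_eq_iff_eq (μ := volume) hcR).1 hae) X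

/-- **C31-M in the literal KNSS class (a.e. formulation): `θ < √(T − t)‖u(t)‖_{L^∞}` frequently as
`t ↑ T`, for every `θ ∈ [0, 1)`.** Let `u` be jointly measurable on `(0,T) × ℝ³` (`T > 0`) with measurable,
weakly divergence-free slices, essentially bounded uniformly on every `(0,T')`, `T' < T`, satisfying
`u(t) = e^{(t−s)Δ}u(s) − B¹_s(u,u)(t)` a.e. in `x` for every pair `0 < s < t < T` (KNSS gauge,
`ν = 1`), with `‖u(t)‖_{L^∞}` unbounded on `(0,T)`. Then
`ENNReal.ofReal θ < ENNReal.ofReal √(T−t) · ‖u(t)‖_{L^∞}` frequently as `t ↑ T` — i.e.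
`limsup_{t↑T} √(T−t)‖u(t)‖_{L^∞} ≥ 1`. NO continuity, regularity, pressure, energy or decay
hypotheses. Via the canonical representative (`oseenMild_ae_representative`) and
`lerayRate_frequently_gt_of_oseenMild_continuous`. [this file; KNSS 2009 §4 + pub-ns-dss T31⁗] -/
theorem lerayRate_frequently_gt_of_oseenMild_ae {T : ℝ} (hT : 0 < T)
    {u : ℝ → EuclideanSpace ℝ (Fin 3) → EuclideanSpace ℝ (Fin 3)}
    (hmeas : AEStronglyMeasurable (uncurry u)
      ((volume : Measure (ℝ × EuclideanSpace ℝ (Fin 3))).restrict (Ioo 0 T ×ˢ univ)))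
    (hslice : ∀ t ∈ Ioo 0 T, AEStronglyMeasurable (u t) volume)
    (hdiv : ∀ t ∈ Ioo 0 T, IsWeaklyDivFree (u t))
    (hbdd : ∀ T' < T, ∃ M : ℝ, ∀ t ∈ Ioo 0 T', eLpNorm (u t) ∞ volume ≤ ENNReal.ofReal M)
    (hoseen : ∀ s t : ℝ, 0 < s → s < t → t < T →
      u t =ᵐ[volume] fun x =>
        UnboundedOperators.heatExtension (u s) (t - s) x - oseenDuhamel 1 s u u t x)
    (hunb : ∀ M : ℝ, ∃ t ∈ Ioo 0 T, ENNReal.ofReal M < eLpNorm (u t) ∞ volume)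
    {θ : ℝ} (hθ0 : 0 ≤ θ) (hθ : θ < 1) :
    ∃ᶠ t in 𝓝[<] T, ENNReal.ofReal θ < ENNReal.ofReal (Real.sqrt (T - t)) * eLpNorm (u t) ∞ volume := by
  set s₀ : ℝ := T / 2 with hs₀def
  have hs₀ : 0 < s₀ := by rw [hs₀def]; linarith
  have hs₀T : s₀ < T := by rw [hs₀def]; linarith
  have hTs : 0 < T - s₀ := sub_pos.2 hs₀T
  -- the canonical representative, as an opaque field `w` with its defining equation
  obtain ⟨w, hw⟩ : ∃ w : ℝ → EuclideanSpace ℝ (Fin 3) → EuclideanSpace ℝ (Fin 3), ∀ t x, w t x =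
      UnboundedOperators.heatExtension (u s₀) (t - s₀) x - oseenDuhamel 1 s₀ u u t x :=
    ⟨_, fun _ _ => rfl⟩
  obtain ⟨hsm, hwu, hbddw, hosw⟩ :=
    oseenMild_ae_representative hs₀ hs₀T hmeas hslice hbdd hoseen hw
  -- the translate `v = w(· + s₀)` on `(0, T − s₀)`
  set v : ℝ → EuclideanSpace ℝ (Fin 3) → EuclideanSpace ℝ (Fin 3) := fun t => w (t + s₀) with hv
  have hcontv : ContinuousOn (uncurry v) (Ioo 0 (T - s₀) ×ˢ univ) := by
    have hφ : Continuous fun z : ℝ × EuclideanSpace ℝ (Fin 3) => (z.1 + s₀, z.2) :=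
      (continuous_fst.add continuous_const).prodMk continuous_snd
    have hmaps : MapsTo (fun z : ℝ × EuclideanSpace ℝ (Fin 3) => (z.1 + s₀, z.2))
        (Ioo 0 (T - s₀) ×ˢ univ) (Ioo s₀ T ×ˢ univ) := fun z hz => by
      obtain ⟨h1, -⟩ := mem_prod.1 hz
      exact ⟨⟨by linarith [h1.1], by linarith [h1.2]⟩, mem_univ _⟩
    exact (hsm.continuousOn.comp hφ.continuousOn hmaps).congr fun z _ => rfl
  have hdivv : ∀ t ∈ Ioo 0 (T - s₀), IsWeaklyDivFree (v t) := by
    intro t ht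
    have htI : t + s₀ ∈ Ioo s₀ T := ⟨by linarith [ht.1], by linarith [ht.2]⟩
    exact (hdiv (t + s₀) ⟨hs₀.trans htI.1, htI.2⟩).congr_ae (hwu (t + s₀) htI).symm
  have hbddv : ∀ T' < T - s₀, ∃ M : ℝ, ∀ t ∈ Ioo 0 T', ∀ x, ‖v t x‖ ≤ M := by
    intro T' hT'
    obtain ⟨M, hM⟩ := hbddw (T' + s₀) (by linarith)
    exact ⟨M, fun t ht x => hM (t + s₀) ⟨by linarith [ht.1], by linarith [ht.2]⟩ x⟩
  have hoseenv : ∀ a b : ℝ, 0 < a → a < b → b < T - s₀ → ∀ X,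
      v b X = UnboundedOperators.heatExtension (v a) (b - a) X - oseenDuhamel 1 a v v b X := by
    intro a b ha hab hb X
    have key := hosw (a + s₀) (b + s₀) (by linarith) (by linarith) (by linarith) X
    rw [hv, oseenDuhamel_translate 1 a s₀ w w b X, show b - a = b + s₀ - (a + s₀) by ring]
    exact key
  -- unboundedness of `v` from the essential unboundedness of `u`
  have hunbv : ∀ M : ℝ, ∃ t ∈ Ioo 0 (T - s₀), ∃ x, M < ‖v t x‖ := by
    intro M
    obtain ⟨M₁, hM₁⟩ := hbdd ((s₀ + T) / 2) (by linarith)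
    set M' : ℝ := max (max M M₁) 0 with hM'def
    obtain ⟨t, ht, hx⟩ := hunb M'
    have hM₁M' : M₁ ≤ M' := (le_max_right _ _).trans (le_max_left _ _)
    have hts : (s₀ + T) / 2 ≤ t := by
      by_contra hlt
      have h := hM₁ t ⟨ht.1, not_le.1 hlt⟩
      exact absurd (hx.trans_le (h.trans (ENNReal.ofReal_le_ofReal hM₁M'))) (lt_irrefl _)
    have htI : t ∈ Ioo s₀ T := ⟨by linarith, ht.2⟩
    -- if `‖w t ·‖ ≤ M'` everywhere then `‖u t‖_∞ ≤ M'`, contradiction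
    by_contra hno
    push Not at hno
    have hwt : ∀ x, ‖w t x‖ ≤ M' := fun x => by
      have h := hno (t - s₀) ⟨by linarith, by linarith [ht.2]⟩ x
      simp only [hv, sub_add_cancel] at h
      exact h.trans ((le_max_left _ _).trans (le_max_left _ _))
    have h1 : eLpNorm (u t) ∞ volume ≤ ENNReal.ofReal M' := by
      rw [← eLpNorm_congr_ae (hwu t htI)]
      exact eLpNorm_top_le_ofReal_of_norm_le hwt
    exact absurd (hx.trans_le h1) (lt_irrefl _)
  -- the continuous rendering at the translated singular time
  have h1 := lerayRate_frequently_gt_of_oseenMild_continuous hTs hcontv hdivv hbddv hoseenv hunbv hθ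
  -- transport along `t ↦ t + s₀` and compare `‖w(t,x)‖ ≤ ‖u(t)‖_∞`
  have htend : Tendsto (fun t : ℝ => t + s₀) (𝓝[<] (T - s₀)) (𝓝[<] T) := by
    have hc : ContinuousWithinAt (fun t : ℝ => t + s₀) (Iio (T - s₀)) (T - s₀) :=
      (continuous_add_const s₀).continuousWithinAt
    have h := hc.tendsto_nhdsWithin (fun t ht => by
      show t + s₀ ∈ Iio T
      rw [mem_Iio] at ht ⊢; linarith)
    rwa [sub_add_cancel] at h
  have hev : ∀ᶠ t in 𝓝[<] (T - s₀), 0 < t ∧ t < T - s₀ := by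
    have h0 : ∀ᶠ t in 𝓝[<] (T - s₀), t ∈ Ioo 0 (T - s₀) := Ioo_mem_nhdsLT hTs
    exact h0.mono fun t ht => ⟨ht.1, ht.2⟩
  refine htend.frequently_map (fun t : ℝ => t + s₀) (fun t ht => ?_) (h1.and_eventually hev)
  obtain ⟨⟨x, hx⟩, ht0, htT⟩ := ht
  have htI : t + s₀ ∈ Ioo s₀ T := ⟨by linarith, by linarith⟩
  have hsq : 0 < Real.sqrt (T - (t + s₀)) := Real.sqrt_pos.2 (by linarith)
  rw [show T - s₀ - t = T - (t + s₀) by ring] at hx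
  -- case on finiteness of `‖u(t)‖_∞`
  rcases eq_or_ne (eLpNorm (u (t + s₀)) ∞ volume) ∞ with htop | hfin
  · rw [htop, ENNReal.mul_top (by simpa using hsq)]
    exact ENNReal.ofReal_lt_top
  · have hcw : Continuous (w (t + s₀)) :=
      hsm.continuousOn.comp_continuous (Continuous.prodMk_right (t + s₀)) fun y => ⟨htI, mem_univ y⟩
    have hle : ‖w (t + s₀) x‖ ≤ (eLpNorm (u (t + s₀)) ∞ volume).toReal := by
      refine norm_le_of_eLpNorm_top_le_of_continuous hcw hfin ?_ x
      rw [eLpNorm_congr_ae (hwu (t + s₀) htI)]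
    have h2 : θ < Real.sqrt (T - (t + s₀)) * (eLpNorm (u (t + s₀)) ∞ volume).toReal :=
      hx.trans_le (mul_le_mul_of_nonneg_left hle hsq.le)
    calc ENNReal.ofReal θ
        < ENNReal.ofReal (Real.sqrt (T - (t + s₀)) * (eLpNorm (u (t + s₀)) ∞ volume).toReal) :=
          (ENNReal.ofReal_lt_ofReal_iff (hθ0.trans_lt h2)).2 h2
      _ = ENNReal.ofReal (Real.sqrt (T - (t + s₀))) * eLpNorm (u (t + s₀)) ∞ volume := by
          rw [ENNReal.ofReal_mul hsq.le, ENNReal.ofReal_toReal hfin]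

end Summit.NavierStokesRegularity.NavierStokesRegularity.Theorems

end
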